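import Summits.Ventures.HodgeRepro2.BallQuotientCoverMeasure
import Summits.Ventures.HodgeRepro2.T5CoveringIntegral
import Summits.Ventures.HodgeRepro2.PeterssonInner

/-!
# Integrals along the finite cover `S'\𝔹² → S\𝔹²`; the Petersson product and the index

Kernel support for the blind cell pub-hodge-repro2 (seat p2), T5-ID §ID-4(b′) / the descent of (N) along
the tower.  Row 40 (`T5CoveringIntegral.lean`) proved the descent formulas from the hypothesis
`map π μ' = d • μ`; row 112 (`BallQuotientCoverMeasure.lean`) proved that hypothesis for the Bergman
quotient measures with `d = [S : S']`.  Putting them together: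

* `∫_{S'\𝔹²} f ∘ π = [S : S'] · ∫_{S\𝔹²} f`, and `∫_{S\𝔹²} f ≠ 0 ⇒ ∫_{S'\𝔹²} f ∘ π ≠ 0`
  (the quantified form used to descend (N) along the tower);
* for weight-`k` forms for `S` (which are weight-`k` forms for `S'`):
  `⟨f, g⟩_{S'} = [S : S'] · ⟨f, g⟩_S` — the classical index normalisation of the Petersson product.
-/

namespace Summit.Ventures.HodgeRepro2.ShimuraData

open MeasureTheory

variable {K : Type*} [Field K] [NumberField K] [NumberField.IsCMField K]
    {τ₁ : K →+* ℂ} {H : Matrix (Fin 3) (Fin 3) K} {Q : Matrix (Fin 3) (Fin 3) ℂ}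
    (hQ : IsFrame K τ₁ H Q) {S' S : Subgroup (GL (Fin 3) K)}

/-- **Integrals along the finite cover**: `∫_{S'\𝔹²} f ∘ π = [S : S'] · ∫_{S\𝔹²} f`. -/
theorem integral_comp_ballQuotientMap (hS'S : S' ≤ S)
    (hS : (S : Set (GL (Fin 3) K)) ⊆ unitaryGroup K H) [(S'.subgroupOf S).FiniteIndex]
    {D : Set ball₂} (hDm : MeasurableSet D) (hD : IsBallFundamentalDomain hQ S hS D)
    (f : ballQuotient hQ S hS → ℂ) (hf : AEStronglyMeasurable f (quotientMeasure hQ S hS D)) :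
    ∫ x, f (ballQuotientMap hQ hS'S hS x)
        ∂quotientMeasure hQ S' (fun _ hγ => hS (hS'S hγ)) (cosetDomain hQ hS (S' := S') D) =
      ((S'.subgroupOf S).index : ℂ) * ∫ x, f x ∂quotientMeasure hQ S hS D :=
  T5CoveringIntegral.integral_comp_eq_smul _ _ _ (measurable_ballQuotientMap hQ hS'S hS).aemeasurable _
    (map_ballQuotientMap_quotientMeasure_cosetDomain hQ hS'S hS hDm hD) f hf

/-- **(N) descends the tower**: a non-vanishing integral on `S\𝔹²` stays non-vanishing on `S'\𝔹²`. -/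
theorem integral_comp_ballQuotientMap_ne_zero (hS'S : S' ≤ S)
    (hS : (S : Set (GL (Fin 3) K)) ⊆ unitaryGroup K H) [hfi : (S'.subgroupOf S).FiniteIndex]
    {D : Set ball₂} (hDm : MeasurableSet D) (hD : IsBallFundamentalDomain hQ S hS D)
    (f : ballQuotient hQ S hS → ℂ) (hf : AEStronglyMeasurable f (quotientMeasure hQ S hS D))
    (h : ∫ x, f x ∂quotientMeasure hQ S hS D ≠ 0) :
    ∫ x, f (ballQuotientMap hQ hS'S hS x)
        ∂quotientMeasure hQ S' (fun _ hγ => hS (hS'S hγ)) (cosetDomain hQ hS (S' := S') D) ≠ 0 :=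
  T5CoveringIntegral.integral_comp_ne_zero _ _ _ (measurable_ballQuotientMap hQ hS'S hS).aemeasurable _
    hfi.index_ne_zero (map_ballQuotientMap_quotientMeasure_cosetDomain hQ hS'S hS hDm hD) f hf h

/-- The quantified form of the descent (row 40's `exists_ne_zero_of_exists_ne_zero`). -/
theorem exists_integral_comp_ballQuotientMap_ne_zero (hS'S : S' ≤ S)
    (hS : (S : Set (GL (Fin 3) K)) ⊆ unitaryGroup K H) [hfi : (S'.subgroupOf S).FiniteIndex]
    {D : Set ball₂} (hDm : MeasurableSet D) (hD : IsBallFundamentalDomain hQ S hS D)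
    {ι : Type*} (f : ι → ballQuotient hQ S hS → ℂ)
    (hf : ∀ i, AEStronglyMeasurable (f i) (quotientMeasure hQ S hS D))
    (h : ∃ i, ∫ x, f i x ∂quotientMeasure hQ S hS D ≠ 0) :
    ∃ i, ∫ x, f i (ballQuotientMap hQ hS'S hS x)
        ∂quotientMeasure hQ S' (fun _ hγ => hS (hS'S hγ)) (cosetDomain hQ hS (S' := S') D) ≠ 0 :=
  T5CoveringIntegral.exists_ne_zero_of_exists_ne_zero _ _ _
    (measurable_ballQuotientMap hQ hS'S hS).aemeasurable _ hfi.index_ne_zero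
    (map_ballQuotientMap_quotientMeasure_cosetDomain hQ hS'S hS hDm hD) f hf h

omit [NumberField K] [NumberField.IsCMField K] in
/-- A weight-`k` function for `S` is a weight-`k` function for every subgroup `S' ≤ S`. -/
theorem IsWeightFor.mono (hS'S : S' ≤ S) {k : ℕ} {f : (Fin 2 → ℂ) → ℂ} (hf : IsWeightFor τ₁ Q S k f) :
    IsWeightFor τ₁ Q S' k f :=
  fun γ hγ z hz => hf γ (hS'S hγ) z hz

/-- The descended Petersson density for `S'` is the pull-back of the one for `S`. -/
theorem peterssonPairQuotient_comp_ballQuotientMap (hS'S : S' ≤ S)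
    (hS : (S : Set (GL (Fin 3) K)) ⊆ unitaryGroup K H) {k : ℕ} {f g : (Fin 2 → ℂ) → ℂ}
    (hf : IsWeightFor τ₁ Q S k f) (hg : IsWeightFor τ₁ Q S k g) :
    peterssonPairQuotient hQ S' (fun _ hγ => hS (hS'S hγ)) (hf.mono hS'S) (hg.mono hS'S) =
      peterssonPairQuotient hQ S hS hf hg ∘ ballQuotientMap hQ hS'S hS := by
  funext x
  obtain ⟨z, rfl⟩ := ballQuotient_mk_surjective hQ S' _ x
  rw [Function.comp_apply, ballQuotientMap_mk, peterssonPairQuotient_mk, peterssonPairQuotient_mk]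

/-- **The Petersson product and the index**: `⟨f, g⟩_{S'} = [S : S'] · ⟨f, g⟩_S` for continuous weight-`k`
forms for `S`, the `S'`-product taken against `quotientMeasure (cosetDomain D)`. -/
theorem peterssonInner_mono_eq_index_mul (hS'S : S' ≤ S)
    (hS : (S : Set (GL (Fin 3) K)) ⊆ unitaryGroup K H) [(S'.subgroupOf S).FiniteIndex]
    {D : Set ball₂} (hDm : MeasurableSet D) (hD : IsBallFundamentalDomain hQ S hS D)
    {k : ℕ} {f g : (Fin 2 → ℂ) → ℂ} (hf : IsWeightFor τ₁ Q S k f) (hg : IsWeightFor τ₁ Q S k g)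
    (hfc : ContinuousOn f ball₂) (hgc : ContinuousOn g ball₂) :
    peterssonInner hQ S' (fun _ hγ => hS (hS'S hγ)) (quotientMeasure hQ S' _ (cosetDomain hQ hS (S' := S') D))
        (hf.mono hS'S) (hg.mono hS'S) =
      ((S'.subgroupOf S).index : ℂ) * peterssonInner hQ S hS (quotientMeasure hQ S hS D) hf hg := by
  unfold peterssonInner
  rw [peterssonPairQuotient_comp_ballQuotientMap hQ hS'S hS hf hg]
  exact integral_comp_ballQuotientMap hQ hS'S hS hDm hD _
    (continuous_peterssonPairQuotient hQ S hS hf hg hfc hgc).aestronglyMeasurable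

end Summit.Ventures.HodgeRepro2.ShimuraData
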